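import Summits.ResolutionOfSingularities.ResolutionOfSingularities.Theorems.MarkingBudgetKernels
import Summits.ResolutionOfSingularities.ResolutionOfSingularities.Theorems.MaxContactCutHugValuationCut
import HarnessLib

/-!
# MaxContactCutMarkingBudget — §12 of the decomp-res node «MarkingBudget» (lens-4 g15; CRITIC-LEDGER row 101
CLEARED) BY NAME on
the host route `MaxContactCut`

Content VERBATIM from the decomp-res lens-4 cumulative file `HOME/decomp-res-lens-4/g18/CouplingCut.lean` (sha256
5bf7b2ca8f7311e8;
its §1–§6 = g14 HugValuationCut, ALREADY in the tree as `Theorems/HugValuationCut{Chains,Classes,Kernels}` +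
`MaxContactCutHugValuationCut`; §7–§12 = g15 «MarkingBudget» @369c12ac; §13–§17 = g16 «WeightDescent»
@1cb1c32f; §18–§23 = g17
«FactorContact» @daf245ab; §24–§31 = g18 «CouplingCut»).  HOME = run/shared/lean/pub/decomp-res.

Tree file 3/3 (inside the Theses cone): 32260 `MaxContactCut.NoSingularSurfaceHuggingTowers` from the two g15
residuals (O) and (L)
modulo the COSTUME ports `ShadowPortAll` + `MarkingPortAll` (`noSingularSurfaceHuggingTowers_of_g15`, EXACT
`…_iff_residuals_g15`, grid
form `…_iff_grid`), necessity port-free (`…_of_item`), and the up-links 32203 / 31570 / 30253 BY NAME through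
the tree kernels of
`MaxContactCutSurfaceShadow` / `MaxContactCutHugValuationCut` (NoCornerTowers discharged by
`CornerTowerDynamics.noCornerTowers_tree`).
(Sources: CossartJannsenSaito2020 Thm. 2.14, Key Thm. 6.40, Cor. 6.37; BierstoneGrigorievMilmanWlodarczyk2011 §3;
CossartPiltant2019; Abhyankar1956; Cutkosky2009 §2.1.)
-/

noncomputable section

open CategoryTheory AlgebraicGeometry IsLocalRing
open Literature.AlgebraicGeometry.Resolution
open Summit.ResolutionOfSingularities.ResolutionOfSingularities.Theses
open Summit.ResolutionOfSingularities.ResolutionOfSingularities.Theorems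
open WeakOrderReduction ForcedTowerClasses DivergentTowerClasses MonomialTowerClasses
open HugDimensionClasses HugDimensionKernels SurfaceShadowClasses SurfaceShadowKernels
open ContactShadowClasses (NoTowerImperfect)
open ContactShadowKernels (noTowerImperfect_of_noTower noTowerImperfect_mono noTower_iff_columns)
open NearPointCut (SingularClass singularSurface_iff_noTower)

namespace Summit.ResolutionOfSingularities.ResolutionOfSingularities.Theorems.HugValuationCut

variable {K : Type} [Field K]

/-! ## §12 (g15 · NEW) Up to the booked MaxContactCut items BY NAME -/

/-- **THE TARGET 32260 `MaxContactCut.NoSingularSurfaceHuggingTowers` BY NAME from the two g15 residuals and the two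
COSTUME ports (engine-free).** [folklore] -/
theorem noSingularSurfaceHuggingTowers_of_g15 (hP : ShadowPortAll) (hM : MarkingPortAll)
    (hO : NoOffLocusShadowTowers) (hL : NoInLocusShadowTowers) : MaxContactCut.NoSingularSurfaceHuggingTowers :=
  fun n hn => singularSurface_of_g15 (hP n hn) (hM n hn) (hO n hn) (hL n hn)

/-- **32260 BY NAME from the three residual cells of the g14 × g15 grid, the two COSTUME ports and g14's engine.**
[folklore] -/
theorem noSingularSurfaceHuggingTowers_of_grid (hP : ShadowPortAll) (hM : MarkingPortAll)
    (hLaw : DiscreteShadowLawAll) (hO : NoOffLocusShadowTowers) (hI : NoInLocusDiscreteImperfectShadowTowers)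
    (hZ : NoInLocusDenseShadowTowers) : MaxContactCut.NoSingularSurfaceHuggingTowers :=
  fun n hn => singularSurface_of_grid (hP n hn) (hM n hn) (hLaw n hn) (hO n hn) (hI n hn) (hZ n hn)

/-- Necessity, port-free: 32260 implies the residual (O). [folklore] -/
theorem noOffLocusShadowTowers_of_item (h : MaxContactCut.NoSingularSurfaceHuggingTowers) :
    NoOffLocusShadowTowers :=
  fun n hn => (pieces_of_singularSurface_g15 (h n hn)).2.1

/-- Necessity, port-free: 32260 implies the residual column (L). [folklore] -/
theorem noInLocusShadowTowers_of_item (h : MaxContactCut.NoSingularSurfaceHuggingTowers) : NoInLocusShadowTowers :=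
  fun n hn => (pieces_of_singularSurface_g15 (h n hn)).2.2.2.1

/-- Necessity, port-free: 32260 implies the cell (L, D-imp). [folklore] -/
theorem noInLocusDiscreteImperfectShadowTowers_of_item (h : MaxContactCut.NoSingularSurfaceHuggingTowers) :
    NoInLocusDiscreteImperfectShadowTowers :=
  fun n hn => (pieces_of_singularSurface_g15 (h n hn)).2.2.2.2.2.1

/-- Necessity, port-free: 32260 implies the cell (L, Z). [folklore] -/
theorem noInLocusDenseShadowTowers_of_item (h : MaxContactCut.NoSingularSurfaceHuggingTowers) :
    NoInLocusDenseShadowTowers :=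
  fun n hn => (pieces_of_singularSurface_g15 (h n hn)).2.2.2.2.2.2

/-- **EXACT at the item, engine-free, modulo the two COSTUME ports**: 32260 ⟺ (O) ∧ (L). [folklore] -/
theorem noSingularSurfaceHuggingTowers_iff_residuals_g15 (hP : ShadowPortAll) (hM : MarkingPortAll) :
    MaxContactCut.NoSingularSurfaceHuggingTowers ↔ NoOffLocusShadowTowers ∧ NoInLocusShadowTowers :=
  ⟨fun h => ⟨noOffLocusShadowTowers_of_item h, noInLocusShadowTowers_of_item h⟩,
    fun h => noSingularSurfaceHuggingTowers_of_g15 hP hM h.1 h.2⟩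

/-- **EXACT at the item modulo ports + engine**: 32260 ⟺ (O) ∧ (L, D-imp) ∧ (L, Z). [folklore] -/
theorem noSingularSurfaceHuggingTowers_iff_grid (hP : ShadowPortAll) (hM : MarkingPortAll)
    (hLaw : DiscreteShadowLawAll) :
    MaxContactCut.NoSingularSurfaceHuggingTowers ↔
      NoOffLocusShadowTowers ∧ NoInLocusDiscreteImperfectShadowTowers ∧ NoInLocusDenseShadowTowers :=
  ⟨fun h => ⟨noOffLocusShadowTowers_of_item h, noInLocusDiscreteImperfectShadowTowers_of_item h,
    noInLocusDenseShadowTowers_of_item h⟩,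
    fun h => noSingularSurfaceHuggingTowers_of_grid hP hM hLaw h.1 h.2.1 h.2.2⟩

/-- **32203 `MaxContactCut.NoSurfaceHuggingTowers` BY NAME** (tree kernel `surfaceLeaf_of_surfaceLaw` + g15).
[folklore] -/
theorem noSurfaceHuggingTowers_of_g15 (hSL : MaxContactCut.SurfaceLawAll) (hP : ShadowPortAll)
    (hM : MarkingPortAll) (hO : NoOffLocusShadowTowers) (hL : NoInLocusShadowTowers) :
    MaxContactCut.NoSurfaceHuggingTowers :=
  fun n hn => surfaceLeaf_of_surfaceLaw (hSL n hn) (noSingularSurfaceHuggingTowers_of_g15 hP hM hO hL n hn)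

/-- **31570 `MaxContactCut.NoHuggingTowers` BY NAME** (tree kernel `MaxContactCutSurfaceShadow.noHuggingTowers_of_g11`;
its corner hypothesis is the tree's `CornerTowerDynamics.noCornerTowers_tree`). [folklore] -/
theorem noHuggingTowers_of_g15 (hMo : MaxContactCut.MonomialCornerAll) (hC : MaxContactCut.CurveLawAll)
    (hSL : MaxContactCut.SurfaceLawAll) (hH : MaxContactCut.NoHypersurfaceHuggingTowers) (hP : ShadowPortAll)
    (hM : MarkingPortAll) (hO : NoOffLocusShadowTowers) (hL : NoInLocusShadowTowers) :
    MaxContactCut.NoHuggingTowers :=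
  MaxContactCutSurfaceShadow.noHuggingTowers_of_g11 hMo CornerTowerDynamics.noCornerTowers_tree hC hSL
    (noSingularSurfaceHuggingTowers_of_g15 hP hM hO hL) hH

/-- **30253 `MaxContactCut.NoForcedTowers` BY NAME** (tree kernel `MaxContactCutSurfaceShadow.noForcedTowers_of_g11`,
corner hypothesis discharged by `CornerTowerDynamics.noCornerTowers_tree`). [folklore] -/
theorem noForcedTowers_of_g15 (hNF : MaxContactCut.CornerNormalFormAll) (hMo : MaxContactCut.MonomialCornerAll)
    (hC : MaxContactCut.CurveLawAll) (hSL : MaxContactCut.SurfaceLawAll)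
    (hH : MaxContactCut.NoHypersurfaceHuggingTowers) (hP : ShadowPortAll) (hM : MarkingPortAll)
    (hO : NoOffLocusShadowTowers) (hL : NoInLocusShadowTowers) : MaxContactCut.NoForcedTowers :=
  MaxContactCutSurfaceShadow.noForcedTowers_of_g11 hNF hMo CornerTowerDynamics.noCornerTowers_tree hC hSL
    (noSingularSurfaceHuggingTowers_of_g15 hP hM hO hL) hH

/-- 30253 from the three residual CELLS of the grid (ports + engine). [folklore] -/
theorem noForcedTowers_of_grid (hNF : MaxContactCut.CornerNormalFormAll) (hMo : MaxContactCut.MonomialCornerAll)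
    (hC : MaxContactCut.CurveLawAll) (hSL : MaxContactCut.SurfaceLawAll)
    (hH : MaxContactCut.NoHypersurfaceHuggingTowers) (hP : ShadowPortAll) (hM : MarkingPortAll)
    (hLaw : DiscreteShadowLawAll) (hO : NoOffLocusShadowTowers) (hI : NoInLocusDiscreteImperfectShadowTowers)
    (hZ : NoInLocusDenseShadowTowers) : MaxContactCut.NoForcedTowers :=
  MaxContactCutSurfaceShadow.noForcedTowers_of_g11 hNF hMo CornerTowerDynamics.noCornerTowers_tree hC hSL
    (noSingularSurfaceHuggingTowers_of_grid hP hM hLaw hO hI hZ) hH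

end Summit.ResolutionOfSingularities.ResolutionOfSingularities.Theorems.HugValuationCut
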